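import Mathlib
import HarnessLib

/-!
# TwoNotchCrawlDefectBudget — the schedule-free crawl identities (III), (M), (Π), IDENTITY D, LEMMA R′ and the
# DEFECT BUDGET THEOREM D / D′ of the PERMISSIVE two-notch book (STAGING; nogo gen 22, `PBOOK-ADDENDUM-5-RIDER-C.md` §2–3,
# `PBOOK-ADDENDUM-5-RIDER-I.md` §1–3)

search for candidate a priori estimates; no regularity claim.

Setting (prose dictionary, as in `TwoNotchPairKinematics` / `TwoNotchStaticConveyor`; the p = 1 PERMISSIVE two-notch K book, sizes
`S_d > S_t > S_u > 0`, chords moving with `dx/dy = v = −T(mid-state)` for a velocity law `T` — the book: `T = tan`; the `anyLaw` section holds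
for ANY `T` strictly increasing on a set `I` containing the five mid-states involved).  A CRAWL STEP of a y-periodic orbit (period `Y`,
translation `X`): the u-letter `π_k` of slot `k` (position `p_k` at height 0, velocity `w_k`, inertial for life by the KICK LEMMA K1) is eaten
at height `m_k` by the eater `Æ` together with the near twin `x̄_k` (velocity `v̄_k`), born at the emitter `E` at height `e_k` together with the
far twin `L_k` (velocity `w_k` again: same slot value) which occupies slot `k`, i.e. position `p_k + X`, at height `Y`; between its meals `k`,
`k+1` the eater, and between its emissions `k`, `k+1` the emitter, are inertial with the SAME velocity `A_k` (KICK LEMMA K2).  Window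
`τ_k = m_k − e_k ≥ 0` (a twin is born before it is eaten).  For a u-DEFECT (`π_k`, `π_{k+1}` of equal sign `σ`, director value `θ` between
them; LINEAR defect: word-adjacent; BOUNDARY defect of a two-pair architecture: separated by the balanced filler `E₂ Æ₂`) the model mids give,
with `a₁ = T(θ − S_t − S_u/2) < a₂ = T(θ − S_t + S_u/2) < a₃ = T(θ − S_t/2) < a₄ = T(θ − S_u/2) < a₅ = T(θ + S_u/2)`:
`σ = +`: `w_k = −a₄, w_{k+1} = −a₅, A_k = −a₃, v̄_k = −a₁, v̄_{k+1} = −a₂`;  `σ = −`: `w_k = −a₅, w_{k+1} = −a₄, A_k = −a₃, v̄_k = −a₂, v̄_{k+1} = −a₁`.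

What is kernel-checked here (everything elementary, `[ours]`; the identities are stated EXACTLY in the form in which `riderI/slotcheck.py`
verified them as vanishing linear functionals on the timing-equality family of 23 388 one-pair + 5 764 two-pair (class, tilt) cases,
residual ≤ 3.1e−15):
* `slot_identity` — (III_k) `X = w_k·Y − (v̄_k − w_k)·τ_k` from the three bookkeeping lines of the zigzag `π_k → (x̄_k, L_k)`;
* `meal_identity` (M_k), `period_identity` (Π_k), `identity_D` — IDENTITY D `(w_{k+1} − w_k)·Y = (A_k − w_{k+1})·τ_{k+1} − (A_k − w_k)·τ_k`
  from (M_k) − (Π_k); `lemma_Rprime` — LEMMA R′ `(v̄_{k+1} − A_k)·τ_{k+1} = (v̄_k − A_k)·τ_k` = D − (III_k − III_{k+1}); `identity_D_of_slot` —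
  conversely D from two slot identities and R′ (this is how the BOUNDARY versions D×, R′× of RIDER I §2 enter: same shape, `θ = b + S_u·Σπ`);
* `budget_nonpos_plus` / `budget_nonpos_minus` (+ strict versions `budget_neg_plus` / `budget_neg_minus`) — the SIGN LEMMA as pure order
  algebra: for ANY reals `a₁ < a₂ < a₃ < a₄ < a₅`, `τ_k ≥ 0`, D and R′ force `Y ≤ 0` (`Y < 0` if `τ_k > 0`);
* `five_chain` — the model mids ARE so ordered for every law `T` strictly increasing on `I` (only `0 < S_u < S_t` is used — no concavity, no sizes);
* `defect_budget_plus` / `defect_budget_minus` — THEOREM D′ (RIDER I §3; RIDER C's THEOREM D is the fully-served-pile instance): on the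
  timing-equality family of ANY architecture containing a crawl step across a linear or boundary u-defect, every schedule, conveyor place, pile
  length and tilt, `τ_k ≥ 0 ⇒ Y ≤ 0` — no y-periodic orbit (`Y > 0`): `no_orbit_plus` / `no_orbit_minus`; `*_tan` — the book's law
  (`Real.strictMonoOn_tan`, admissibility = the extreme mid-states lie in `(−π/2, π/2)`);
* `too_slow`, `too_slow_mid` — the TOO-SLOW LEMMA (RIDER I §5): (III_k) with the conveyor identity CV1 `X − v_P⁰·Y = Δ_P·ℓ` (`ℓ = c₄ − c₂ ≥ 0`,
  `Δ_P > 0`, `v̄_k − w_k > 0`) gives `(w_k − v_P⁰)·Y ≥ 0`, so on an orbit every pile letter is at least as fast (rightward) as the loaded director: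
  `mid(π_k) ≤ b + S_d/2`.
NOT checked by Lean (pen, RIDER D §1 KICK LEMMA, RIDER I §1–2, cross-checked on the engine of record `korbit/morbit.py`): that the bookkeeping
hypotheses ARE the kinematics of a crawl step (inertia K1/K2, slot periodicity, the zigzag genealogy, `τ_k ≥ 0`), and the dictionary of mids above.
The u-part of CONJECTURE LCA / U-ORD′ beyond crawl genealogies (the GENEALOGY claim of RIDER I §6) is OPEN and is not asserted here.
Nothing is claimed about Navier–Stokes.
-/

noncomputable section

namespace Summit.NavierStokesRegularity.FunctionalMining.TwoNotchCrawlDefectBudget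

/-! ## §1  Bookkeeping identities (law-free linear algebra) -/

/-- (III_k) the SLOT / ZIGZAG identity.  `PE` = position of the emitter at the birth height `e` of the twins `(L_k, x̄_k)`, `PA` = position of
the eater at the meal height `m`; `p` = slot position of `π_k` at height 0, `w` = velocity of `π_k` and of `L_k`, `vb` = velocity of `x̄_k`. -/
theorem slot_identity {X Y p w vb e m PE PA : ℝ}
    (hL : PE + w * (Y - e) = p + X)        -- the far twin `L_k` sits in slot `k` (position `p + X`) at height `Y`
    (hxb : PA = PE + vb * (m - e))         -- the near twin `x̄_k` reaches the eater at height `m`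
    (hπ : PA = p + w * m) :                -- `π_k`, inertial from `p`, reaches the eater at height `m`
    X = w * Y - (vb - w) * (m - e) := by
  linear_combination (-1 : ℝ) * hL - hxb + hπ

/-- (M_k) MEAL identity: the eater is inertial at velocity `A` between meal `k` (height `mk`, position `PAk`) and meal `k+1`. -/
theorem meal_identity {g pk pk1 wk wk1 A mk mk1 PAk PAk1 : ℝ}
    (hg : g = pk1 - pk) (hπk : PAk = pk + wk * mk) (hπk1 : PAk1 = pk1 + wk1 * mk1)
    (hA : PAk1 - PAk = A * (mk1 - mk)) :
    g = (A - wk1) * mk1 - (A - wk) * mk := by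
  linear_combination hg + hπk - hπk1 + hA

/-- (Π_k) PERIOD identity: the emitter is inertial at the same velocity `A` between emission `k` (height `ek`, position `PEk`) and emission
`k+1`, and the far twins `L_k`, `L_{k+1}` occupy slots `k`, `k+1` at height `Y`. -/
theorem period_identity {g pk pk1 wk wk1 A ek ek1 PEk PEk1 X Y : ℝ}
    (hg : g = pk1 - pk) (hLk : PEk + wk * (Y - ek) = pk + X) (hLk1 : PEk1 + wk1 * (Y - ek1) = pk1 + X)
    (hA : PEk1 - PEk = A * (ek1 - ek)) :
    g = (A - wk1) * ek1 - (A - wk) * ek + (wk1 - wk) * Y := by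
  linear_combination hg + hLk - hLk1 + hA

/-- IDENTITY D (the defect budget identity) = (M_k) − (Π_k): schedule-free. -/
theorem identity_D {g wk wk1 A ek ek1 mk mk1 Y : ℝ}
    (hM : g = (A - wk1) * mk1 - (A - wk) * mk)
    (hP : g = (A - wk1) * ek1 - (A - wk) * ek + (wk1 - wk) * Y) :
    (wk1 - wk) * Y = (A - wk1) * (mk1 - ek1) - (A - wk) * (mk - ek) := by
  linear_combination hM - hP

/-- LEMMA R′ = D − (III_k − III_{k+1}): schedule-free (no per-schedule re-derivation). -/
theorem lemma_Rprime {X Y wk wk1 vbk vbk1 A τk τk1 : ℝ}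
    (hIIIk : X = wk * Y - (vbk - wk) * τk) (hIIIk1 : X = wk1 * Y - (vbk1 - wk1) * τk1)
    (hD : (wk1 - wk) * Y = (A - wk1) * τk1 - (A - wk) * τk) :
    (vbk1 - A) * τk1 = (vbk - A) * τk := by
  linear_combination hIIIk1 - hIIIk + hD

/-- Conversely IDENTITY D from two slot identities and R′ — the route by which the pile-BOUNDARY versions D×, R′× (two-pair architectures,
RIDER I §2) feed the same budget. -/
theorem identity_D_of_slot {X Y wa wc vba vbc A τa τc : ℝ}
    (hIIIa : X = wa * Y - (vba - wa) * τa) (hIIIc : X = wc * Y - (vbc - wc) * τc)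
    (hR : (vbc - A) * τc = (vba - A) * τa) :
    (wc - wa) * Y = (A - wc) * τc - (A - wa) * τa := by
  linear_combination hIIIa - hIIIc + hR

/-! ## §2  The SIGN LEMMA as order algebra -/

/-- Defect budget, `σ = +` (`w_k = −a₄, w_{k+1} = −a₅, A = −a₃, v̄_k = −a₁, v̄_{k+1} = −a₂`): D and R′ with `τ_k ≥ 0` force `Y ≤ 0`. -/
theorem budget_nonpos_plus {a1 a2 a3 a4 a5 τ τ' Y : ℝ}
    (h12 : a1 < a2) (h23 : a2 < a3) (h34 : a3 < a4) (h45 : a4 < a5) (hτ : 0 ≤ τ)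
    (hD : (a4 - a5) * Y = (a5 - a3) * τ' - (a4 - a3) * τ)
    (hR : (a3 - a2) * τ' = (a3 - a1) * τ) : Y ≤ 0 := by
  have h1 : (a3 - a2) * (τ' - τ) = (a2 - a1) * τ := by linear_combination hR
  have h2 : 0 ≤ (a2 - a1) * τ := mul_nonneg (by linarith) hτ
  have h3 : 0 ≤ τ' - τ := by
    by_contra hc
    have : (a3 - a2) * (τ' - τ) < 0 := mul_neg_of_pos_of_neg (by linarith) (not_le.mp hc)
    linarith
  have h4 : 0 ≤ (a5 - a3) * (τ' - τ) := mul_nonneg (by linarith) h3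
  have h5 : 0 ≤ (a5 - a4) * τ := mul_nonneg (by linarith) hτ
  have h6 : 0 ≤ (a4 - a5) * Y := by
    have : (a4 - a5) * Y = (a5 - a3) * (τ' - τ) + (a5 - a4) * τ := by linear_combination hD
    linarith
  by_contra hc
  have : (a4 - a5) * Y < 0 := mul_neg_of_neg_of_pos (by linarith) (not_le.mp hc)
  linarith

/-- Strict form, `σ = +`: a positive window `τ_k > 0` forces `Y < 0`. -/
theorem budget_neg_plus {a1 a2 a3 a4 a5 τ τ' Y : ℝ}
    (h12 : a1 < a2) (h23 : a2 < a3) (h34 : a3 < a4) (h45 : a4 < a5) (hτ : 0 < τ)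
    (hD : (a4 - a5) * Y = (a5 - a3) * τ' - (a4 - a3) * τ)
    (hR : (a3 - a2) * τ' = (a3 - a1) * τ) : Y < 0 := by
  have h1 : (a3 - a2) * (τ' - τ) = (a2 - a1) * τ := by linear_combination hR
  have h2 : 0 < (a2 - a1) * τ := mul_pos (by linarith) hτ
  have h3 : 0 < τ' - τ := by
    by_contra hc
    have : (a3 - a2) * (τ' - τ) ≤ 0 := mul_nonpos_of_nonneg_of_nonpos (by linarith) (not_lt.mp hc)
    linarith
  have h4 : 0 < (a5 - a3) * (τ' - τ) := mul_pos (by linarith) h3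
  have h5 : 0 < (a5 - a4) * τ := mul_pos (by linarith) hτ
  have h6 : 0 < (a4 - a5) * Y := by
    have : (a4 - a5) * Y = (a5 - a3) * (τ' - τ) + (a5 - a4) * τ := by linear_combination hD
    linarith
  by_contra hc
  have : (a4 - a5) * Y ≤ 0 := mul_nonpos_of_nonpos_of_nonneg (by linarith) (not_lt.mp hc)
  linarith

/-- Defect budget, `σ = −` (`w_k = −a₅, w_{k+1} = −a₄, A = −a₃, v̄_k = −a₂, v̄_{k+1} = −a₁`): D and R′ with `τ_k ≥ 0` force `Y ≤ 0`. -/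
theorem budget_nonpos_minus {a1 a2 a3 a4 a5 τ τ' Y : ℝ}
    (h12 : a1 < a2) (h23 : a2 < a3) (h34 : a3 < a4) (h45 : a4 < a5) (hτ : 0 ≤ τ)
    (hD : (a5 - a4) * Y = (a4 - a3) * τ' - (a5 - a3) * τ)
    (hR : (a3 - a1) * τ' = (a3 - a2) * τ) : Y ≤ 0 := by
  have h1 : (a3 - a1) * (τ - τ') = (a2 - a1) * τ := by linear_combination (-1 : ℝ) * hR
  have h2 : 0 ≤ (a2 - a1) * τ := mul_nonneg (by linarith) hτ
  have h3 : 0 ≤ τ - τ' := by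
    by_contra hc
    have : (a3 - a1) * (τ - τ') < 0 := mul_neg_of_pos_of_neg (by linarith) (not_le.mp hc)
    linarith
  have h4 : 0 ≤ (a4 - a3) * (τ - τ') := mul_nonneg (by linarith) h3
  have h5 : 0 ≤ (a5 - a4) * τ := mul_nonneg (by linarith) hτ
  have h6 : (a5 - a4) * Y ≤ 0 := by
    have : (a5 - a4) * Y = -((a4 - a3) * (τ - τ')) - (a5 - a4) * τ := by linear_combination hD
    linarith
  by_contra hc
  have : 0 < (a5 - a4) * Y := mul_pos (by linarith) (not_le.mp hc)
  linarith

/-- Strict form, `σ = −`. -/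
theorem budget_neg_minus {a1 a2 a3 a4 a5 τ τ' Y : ℝ}
    (h12 : a1 < a2) (h23 : a2 < a3) (h34 : a3 < a4) (h45 : a4 < a5) (hτ : 0 < τ)
    (hD : (a5 - a4) * Y = (a4 - a3) * τ' - (a5 - a3) * τ)
    (hR : (a3 - a1) * τ' = (a3 - a2) * τ) : Y < 0 := by
  have h1 : (a3 - a1) * (τ - τ') = (a2 - a1) * τ := by linear_combination (-1 : ℝ) * hR
  have h2 : 0 < (a2 - a1) * τ := mul_pos (by linarith) hτ
  have h3 : 0 ≤ τ - τ' := by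
    by_contra hc
    have : (a3 - a1) * (τ - τ') < 0 := mul_neg_of_pos_of_neg (by linarith) (not_le.mp hc)
    linarith
  have h4 : 0 ≤ (a4 - a3) * (τ - τ') := mul_nonneg (by linarith) h3
  have h5 : 0 < (a5 - a4) * τ := mul_pos (by linarith) hτ
  have h6 : (a5 - a4) * Y < 0 := by
    have : (a5 - a4) * Y = -((a4 - a3) * (τ - τ')) - (a5 - a4) * τ := by linear_combination hD
    linarith
  by_contra hc
  have : 0 ≤ (a5 - a4) * Y := mul_nonneg (by linarith) (not_lt.mp hc)
  linarith

/-! ## §3  The model mids are so ordered, for every strictly increasing law -/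

section anyLaw

variable {T : ℝ → ℝ} {I : Set ℝ}

/-- The five mid-states of a defect crawl step are strictly ordered under any law strictly increasing on `I` (uses only `0 < S_u < S_t`). -/
theorem five_chain (hT : StrictMonoOn T I) {θ St Su : ℝ} (hSu : 0 < Su) (hSt : Su < St)
    (m1 : θ - St - Su / 2 ∈ I) (m2 : θ - St + Su / 2 ∈ I) (m3 : θ - St / 2 ∈ I) (m4 : θ - Su / 2 ∈ I)
    (m5 : θ + Su / 2 ∈ I) :
    T (θ - St - Su / 2) < T (θ - St + Su / 2) ∧ T (θ - St + Su / 2) < T (θ - St / 2) ∧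
      T (θ - St / 2) < T (θ - Su / 2) ∧ T (θ - Su / 2) < T (θ + Su / 2) :=
  ⟨hT m1 m2 (by linarith), hT m2 m3 (by linarith), hT m3 m4 (by linarith), hT m4 m5 (by linarith)⟩

/-- THEOREM D′, `σ = +` (defect `+u +u`, director value `θ` between the two letters): on the timing-equality family of any architecture
containing this crawl step, IDENTITY D and LEMMA R′ (engine form) with the window `τ_k = m_k − e_k ≥ 0` force `Y ≤ 0`. -/
theorem defect_budget_plus (hT : StrictMonoOn T I) {θ St Su wk wk1 A vbk vbk1 Y τk τk1 : ℝ}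
    (hSu : 0 < Su) (hSt : Su < St)
    (m1 : θ - St - Su / 2 ∈ I) (m2 : θ - St + Su / 2 ∈ I) (m3 : θ - St / 2 ∈ I) (m4 : θ - Su / 2 ∈ I)
    (m5 : θ + Su / 2 ∈ I)
    (hwk : wk = -T (θ - Su / 2)) (hwk1 : wk1 = -T (θ + Su / 2)) (hA : A = -T (θ - St / 2))
    (hvbk : vbk = -T (θ - St - Su / 2)) (hvbk1 : vbk1 = -T (θ - St + Su / 2))
    (hτ : 0 ≤ τk)
    (hD : (wk1 - wk) * Y = (A - wk1) * τk1 - (A - wk) * τk)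
    (hR : (vbk1 - A) * τk1 = (vbk - A) * τk) : Y ≤ 0 := by
  obtain ⟨h12, h23, h34, h45⟩ := five_chain hT hSu hSt m1 m2 m3 m4 m5
  subst hwk hwk1 hA hvbk hvbk1
  exact budget_nonpos_plus (Y := Y) (τ' := τk1) h12 h23 h34 h45 hτ (by linear_combination hD)
    (by linear_combination hR)

/-- THEOREM D′, `σ = +`, strict: a positive window forces `Y < 0`. -/
theorem defect_budget_plus_strict (hT : StrictMonoOn T I) {θ St Su wk wk1 A vbk vbk1 Y τk τk1 : ℝ}
    (hSu : 0 < Su) (hSt : Su < St)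
    (m1 : θ - St - Su / 2 ∈ I) (m2 : θ - St + Su / 2 ∈ I) (m3 : θ - St / 2 ∈ I) (m4 : θ - Su / 2 ∈ I)
    (m5 : θ + Su / 2 ∈ I)
    (hwk : wk = -T (θ - Su / 2)) (hwk1 : wk1 = -T (θ + Su / 2)) (hA : A = -T (θ - St / 2))
    (hvbk : vbk = -T (θ - St - Su / 2)) (hvbk1 : vbk1 = -T (θ - St + Su / 2))
    (hτ : 0 < τk)
    (hD : (wk1 - wk) * Y = (A - wk1) * τk1 - (A - wk) * τk)
    (hR : (vbk1 - A) * τk1 = (vbk - A) * τk) : Y < 0 := by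
  obtain ⟨h12, h23, h34, h45⟩ := five_chain hT hSu hSt m1 m2 m3 m4 m5
  subst hwk hwk1 hA hvbk hvbk1
  exact budget_neg_plus (Y := Y) (τ' := τk1) h12 h23 h34 h45 hτ (by linear_combination hD)
    (by linear_combination hR)

/-- THEOREM D′, `σ = −` (defect `−u −u`). -/
theorem defect_budget_minus (hT : StrictMonoOn T I) {θ St Su wk wk1 A vbk vbk1 Y τk τk1 : ℝ}
    (hSu : 0 < Su) (hSt : Su < St)
    (m1 : θ - St - Su / 2 ∈ I) (m2 : θ - St + Su / 2 ∈ I) (m3 : θ - St / 2 ∈ I) (m4 : θ - Su / 2 ∈ I)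
    (m5 : θ + Su / 2 ∈ I)
    (hwk : wk = -T (θ + Su / 2)) (hwk1 : wk1 = -T (θ - Su / 2)) (hA : A = -T (θ - St / 2))
    (hvbk : vbk = -T (θ - St + Su / 2)) (hvbk1 : vbk1 = -T (θ - St - Su / 2))
    (hτ : 0 ≤ τk)
    (hD : (wk1 - wk) * Y = (A - wk1) * τk1 - (A - wk) * τk)
    (hR : (vbk1 - A) * τk1 = (vbk - A) * τk) : Y ≤ 0 := by
  obtain ⟨h12, h23, h34, h45⟩ := five_chain hT hSu hSt m1 m2 m3 m4 m5
  subst hwk hwk1 hA hvbk hvbk1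
  exact budget_nonpos_minus (Y := Y) (τ' := τk1) h12 h23 h34 h45 hτ (by linear_combination hD)
    (by linear_combination hR)

/-- THEOREM D′, `σ = −`, strict. -/
theorem defect_budget_minus_strict (hT : StrictMonoOn T I) {θ St Su wk wk1 A vbk vbk1 Y τk τk1 : ℝ}
    (hSu : 0 < Su) (hSt : Su < St)
    (m1 : θ - St - Su / 2 ∈ I) (m2 : θ - St + Su / 2 ∈ I) (m3 : θ - St / 2 ∈ I) (m4 : θ - Su / 2 ∈ I)
    (m5 : θ + Su / 2 ∈ I)
    (hwk : wk = -T (θ + Su / 2)) (hwk1 : wk1 = -T (θ - Su / 2)) (hA : A = -T (θ - St / 2))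
    (hvbk : vbk = -T (θ - St + Su / 2)) (hvbk1 : vbk1 = -T (θ - St - Su / 2))
    (hτ : 0 < τk)
    (hD : (wk1 - wk) * Y = (A - wk1) * τk1 - (A - wk) * τk)
    (hR : (vbk1 - A) * τk1 = (vbk - A) * τk) : Y < 0 := by
  obtain ⟨h12, h23, h34, h45⟩ := five_chain hT hSu hSt m1 m2 m3 m4 m5
  subst hwk hwk1 hA hvbk hvbk1
  exact budget_neg_minus (Y := Y) (τ' := τk1) h12 h23 h34 h45 hτ (by linear_combination hD)
    (by linear_combination hR)

/-- NO ORBIT, `σ = +`: from the raw bookkeeping of the two crawl steps `k`, `k+1` (three zigzag lines each, eater and emitter inertial at the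
shared velocity `A` across the step, `e_k ≤ m_k`) there is no positive period. -/
theorem no_orbit_plus (hT : StrictMonoOn T I)
    {θ St Su wk wk1 A vbk vbk1 X Y g pk pk1 ek ek1 mk mk1 PEk PEk1 PAk PAk1 : ℝ}
    (hSu : 0 < Su) (hSt : Su < St)
    (m1 : θ - St - Su / 2 ∈ I) (m2 : θ - St + Su / 2 ∈ I) (m3 : θ - St / 2 ∈ I) (m4 : θ - Su / 2 ∈ I)
    (m5 : θ + Su / 2 ∈ I)
    (hwk : wk = -T (θ - Su / 2)) (hwk1 : wk1 = -T (θ + Su / 2)) (hA : A = -T (θ - St / 2))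
    (hvbk : vbk = -T (θ - St - Su / 2)) (hvbk1 : vbk1 = -T (θ - St + Su / 2))
    (hg : g = pk1 - pk)
    (hLk : PEk + wk * (Y - ek) = pk + X) (hxbk : PAk = PEk + vbk * (mk - ek)) (hπk : PAk = pk + wk * mk)
    (hLk1 : PEk1 + wk1 * (Y - ek1) = pk1 + X) (hxbk1 : PAk1 = PEk1 + vbk1 * (mk1 - ek1))
    (hπk1 : PAk1 = pk1 + wk1 * mk1)
    (hAm : PAk1 - PAk = A * (mk1 - mk)) (hAe : PEk1 - PEk = A * (ek1 - ek))
    (hwin : ek ≤ mk) : ¬ 0 < Y := by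
  have hIIIk := slot_identity hLk hxbk hπk
  have hIIIk1 := slot_identity hLk1 hxbk1 hπk1
  have hD := identity_D (meal_identity hg hπk hπk1 hAm) (period_identity hg hLk hLk1 hAe)
  have hR := lemma_Rprime hIIIk hIIIk1 hD
  have hY : Y ≤ 0 := defect_budget_plus hT hSu hSt m1 m2 m3 m4 m5 hwk hwk1 hA hvbk hvbk1 (sub_nonneg.2 hwin) hD hR
  exact not_lt.2 hY

/-- NO ORBIT, `σ = −`. -/
theorem no_orbit_minus (hT : StrictMonoOn T I)
    {θ St Su wk wk1 A vbk vbk1 X Y g pk pk1 ek ek1 mk mk1 PEk PEk1 PAk PAk1 : ℝ}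
    (hSu : 0 < Su) (hSt : Su < St)
    (m1 : θ - St - Su / 2 ∈ I) (m2 : θ - St + Su / 2 ∈ I) (m3 : θ - St / 2 ∈ I) (m4 : θ - Su / 2 ∈ I)
    (m5 : θ + Su / 2 ∈ I)
    (hwk : wk = -T (θ + Su / 2)) (hwk1 : wk1 = -T (θ - Su / 2)) (hA : A = -T (θ - St / 2))
    (hvbk : vbk = -T (θ - St + Su / 2)) (hvbk1 : vbk1 = -T (θ - St - Su / 2))
    (hg : g = pk1 - pk)
    (hLk : PEk + wk * (Y - ek) = pk + X) (hxbk : PAk = PEk + vbk * (mk - ek)) (hπk : PAk = pk + wk * mk)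
    (hLk1 : PEk1 + wk1 * (Y - ek1) = pk1 + X) (hxbk1 : PAk1 = PEk1 + vbk1 * (mk1 - ek1))
    (hπk1 : PAk1 = pk1 + wk1 * mk1)
    (hAm : PAk1 - PAk = A * (mk1 - mk)) (hAe : PEk1 - PEk = A * (ek1 - ek))
    (hwin : ek ≤ mk) : ¬ 0 < Y := by
  have hIIIk := slot_identity hLk hxbk hπk
  have hIIIk1 := slot_identity hLk1 hxbk1 hπk1
  have hD := identity_D (meal_identity hg hπk hπk1 hAm) (period_identity hg hLk hLk1 hAe)
  have hR := lemma_Rprime hIIIk hIIIk1 hD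
  have hY : Y ≤ 0 := defect_budget_minus hT hSu hSt m1 m2 m3 m4 m5 hwk hwk1 hA hvbk hvbk1 (sub_nonneg.2 hwin) hD hR
  exact not_lt.2 hY

/-- TOO-SLOW LEMMA (law-free part): (III_k) and the conveyor identity CV1 give `(w_k − v_P⁰)·Y = (v̄_k − w_k)·τ_k + Δ_P·ℓ ≥ 0`, so on an
orbit (`Y > 0`) the pile letter is at least as fast as the loaded director: `v_P⁰ ≤ w_k`. -/
theorem too_slow {X Y w vb vP0 ΔP τ ℓ : ℝ}
    (hIII : X = w * Y - (vb - w) * τ) (hCV1 : X - vP0 * Y = ΔP * ℓ)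
    (hDk : 0 < vb - w) (hΔ : 0 < ΔP) (hτ : 0 ≤ τ) (hℓ : 0 ≤ ℓ) (hY : 0 < Y) : vP0 ≤ w := by
  have h1 : (w - vP0) * Y = (vb - w) * τ + ΔP * ℓ := by linear_combination hCV1 - hIII
  have h2 : 0 ≤ (vb - w) * τ := mul_nonneg hDk.le hτ
  have h3 : 0 ≤ ΔP * ℓ := mul_nonneg hΔ.le hℓ
  by_contra hc
  have hc' : w < vP0 := not_le.mp hc
  have : (w - vP0) * Y < 0 := mul_neg_of_neg_of_pos (by linarith) hY
  linarith

/-- TOO-SLOW LEMMA, model reading: with `w_k = −T(μ_k)`, `v̄_k = −T(μ_k − S_t)`, `v_P⁰ = −T(b + S_d/2)`, `v_P¹ = −T(b + S_d/2 − S_t)`,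
`Δ_P = v_P¹ − v_P⁰`, an orbit forces `μ_k ≤ b + S_d/2` (every pile mid is at most the loaded director's mid). -/
theorem too_slow_mid (hT : StrictMonoOn T I) {X Y μ b Sd St w vb vP0 vP1 τ ℓ : ℝ} (hSt : 0 < St)
    (mμ : μ ∈ I) (mμ' : μ - St ∈ I) (mP : b + Sd / 2 ∈ I) (mP' : b + Sd / 2 - St ∈ I)
    (hw : w = -T μ) (hvb : vb = -T (μ - St)) (hvP0 : vP0 = -T (b + Sd / 2)) (hvP1 : vP1 = -T (b + Sd / 2 - St))
    (hIII : X = w * Y - (vb - w) * τ) (hCV1 : X - vP0 * Y = (vP1 - vP0) * ℓ)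
    (hτ : 0 ≤ τ) (hℓ : 0 ≤ ℓ) (hY : 0 < Y) : μ ≤ b + Sd / 2 := by
  have hDk : 0 < vb - w := by
    rw [hw, hvb]; have := hT mμ' mμ (by linarith); linarith
  have hΔ : 0 < vP1 - vP0 := by
    rw [hvP0, hvP1]; have := hT mP' mP (by linarith); linarith
  have key := too_slow hIII hCV1 hDk hΔ hτ hℓ hY
  rw [hw, hvP0] at key
  have key' : T μ ≤ T (b + Sd / 2) := by linarith
  exact (hT.le_iff_le mμ mP).1 key'

end anyLaw

/-! ## §4  The book's law `T = tan` -/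

open Real in
/-- THEOREM D′ for the book (`v = −tan(mid)`), `σ = +`: admissibility = the extreme mid-states lie in `(−π/2, π/2)`. -/
theorem defect_budget_plus_tan {θ St Su wk wk1 A vbk vbk1 Y τk τk1 : ℝ}
    (hSu : 0 < Su) (hSt : Su < St) (lo : -(π / 2) < θ - St - Su / 2) (hi : θ + Su / 2 < π / 2)
    (hwk : wk = -tan (θ - Su / 2)) (hwk1 : wk1 = -tan (θ + Su / 2)) (hA : A = -tan (θ - St / 2))
    (hvbk : vbk = -tan (θ - St - Su / 2)) (hvbk1 : vbk1 = -tan (θ - St + Su / 2))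
    (hτ : 0 ≤ τk)
    (hD : (wk1 - wk) * Y = (A - wk1) * τk1 - (A - wk) * τk)
    (hR : (vbk1 - A) * τk1 = (vbk - A) * τk) : Y ≤ 0 :=
  defect_budget_plus strictMonoOn_tan hSu hSt
    (Set.mem_Ioo.2 ⟨by linarith, by linarith⟩) (Set.mem_Ioo.2 ⟨by linarith, by linarith⟩)
    (Set.mem_Ioo.2 ⟨by linarith, by linarith⟩) (Set.mem_Ioo.2 ⟨by linarith, by linarith⟩)
    (Set.mem_Ioo.2 ⟨by linarith, by linarith⟩) hwk hwk1 hA hvbk hvbk1 hτ hD hR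

open Real in
/-- THEOREM D′ for the book, `σ = −`. -/
theorem defect_budget_minus_tan {θ St Su wk wk1 A vbk vbk1 Y τk τk1 : ℝ}
    (hSu : 0 < Su) (hSt : Su < St) (lo : -(π / 2) < θ - St - Su / 2) (hi : θ + Su / 2 < π / 2)
    (hwk : wk = -tan (θ + Su / 2)) (hwk1 : wk1 = -tan (θ - Su / 2)) (hA : A = -tan (θ - St / 2))
    (hvbk : vbk = -tan (θ - St + Su / 2)) (hvbk1 : vbk1 = -tan (θ - St - Su / 2))
    (hτ : 0 ≤ τk)
    (hD : (wk1 - wk) * Y = (A - wk1) * τk1 - (A - wk) * τk)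
    (hR : (vbk1 - A) * τk1 = (vbk - A) * τk) : Y ≤ 0 :=
  defect_budget_minus strictMonoOn_tan hSu hSt
    (Set.mem_Ioo.2 ⟨by linarith, by linarith⟩) (Set.mem_Ioo.2 ⟨by linarith, by linarith⟩)
    (Set.mem_Ioo.2 ⟨by linarith, by linarith⟩) (Set.mem_Ioo.2 ⟨by linarith, by linarith⟩)
    (Set.mem_Ioo.2 ⟨by linarith, by linarith⟩) hwk hwk1 hA hvbk hvbk1 hτ hD hR

end Summit.NavierStokesRegularity.FunctionalMining.TwoNotchCrawlDefectBudget
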